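import Mathlib
import Literature.Computability.AlgebraicComplexity.PermanentIrreducible

/-!
# `stub_coef_isHomogeneous` (stmt-ValiantsHypothesis-5644, line `Sketch`)

Every `x`-coefficient of `det (A₀ + Σ_e x_e A_e)` — the generic `5 × 5` affine pencil whose
unknowns are the entries of `A₀, A_e` — is a quintic form in the 250 unknowns.

Proof: the property "every `x`-coefficient of `q` is a form of degree `k` in the unknowns"
(coefficientwise homogeneity of degree `k`) is closed under sums (same degree), products (degrees
add, `MvPolynomial.coeff_mul`) and sign changes; every entry of the pencil is coefficientwise
homogeneous of degree `1`, and `det` is a signed sum of products of five entries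
(`Matrix.det_apply`).
-/

noncomputable section
set_option linter.dupNamespace false

namespace Summit.ValiantsHypothesis.ValiantsHypothesis.Theorems.RefutationDegreeSmallCaseThreeFive

open Literature.Computability.AlgebraicComplexity MvPolynomial
open scoped BigOperators Matrix

section CoeffHom

variable {σ τ R : Type*}

/-- Coefficientwise homogeneity is closed under finite sums (same degree). -/
theorem coeffHom_sum [CommSemiring R] {ι : Type*} (s : Finset ι)
    (f : ι → MvPolynomial σ (MvPolynomial τ R)) (k : ℕ)
    (h : ∀ i ∈ s, ∀ m, ((f i).coeff m).IsHomogeneous k) (m : σ →₀ ℕ) :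
    ((∑ i ∈ s, f i).coeff m).IsHomogeneous k := by
  rw [coeff_sum]
  exact IsHomogeneous.sum s _ k fun i hi => h i hi m

/-- Coefficientwise homogeneity is multiplicative (degrees add): a coefficient of a product is a
sum over splittings of products of coefficients. -/
theorem coeffHom_mul [CommSemiring R] {p q : MvPolynomial σ (MvPolynomial τ R)} {j k : ℕ}
    (hp : ∀ m, (p.coeff m).IsHomogeneous j) (hq : ∀ m, (q.coeff m).IsHomogeneous k)
    (m : σ →₀ ℕ) : ((p * q).coeff m).IsHomogeneous (j + k) := by
  classical
  rw [coeff_mul]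
  exact IsHomogeneous.sum _ _ _ fun x _ => (hp x.1).mul (hq x.2)

/-- A constant `C a` with `a` a form of degree `k` is coefficientwise homogeneous of degree `k`. -/
theorem coeffHom_C [CommSemiring R] {a : MvPolynomial τ R} {k : ℕ} (ha : a.IsHomogeneous k)
    (m : σ →₀ ℕ) : ((C a : MvPolynomial σ (MvPolynomial τ R)).coeff m).IsHomogeneous k := by
  classical
  rw [coeff_C]
  split_ifs
  · exact ha
  · exact isHomogeneous_zero _ _ _

/-- `X e * C a` with `a` a form of degree `k` is coefficientwise homogeneous of degree `k`. -/
theorem coeffHom_X_mul_C [CommSemiring R] (e : σ) {a : MvPolynomial τ R} {k : ℕ}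
    (ha : a.IsHomogeneous k) (m : σ →₀ ℕ) :
    ((X e * C a : MvPolynomial σ (MvPolynomial τ R)).coeff m).IsHomogeneous k := by
  classical
  rw [coeff_X_mul']
  split_ifs
  · exact coeffHom_C ha _
  · exact isHomogeneous_zero _ _ _

/-- Coefficientwise homogeneity of a finite product: degrees add up. -/
theorem coeffHom_prod [CommSemiring R] {ι : Type*} (s : Finset ι)
    (f : ι → MvPolynomial σ (MvPolynomial τ R)) (k : ι → ℕ)
    (h : ∀ i ∈ s, ∀ m, ((f i).coeff m).IsHomogeneous (k i)) :
    ∀ m, ((∏ i ∈ s, f i).coeff m).IsHomogeneous (∑ i ∈ s, k i) := by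
  classical
  induction s using Finset.induction_on with
  | empty =>
    intro m
    simpa only [Finset.prod_empty, Finset.sum_empty, C_1] using
      (coeffHom_C (σ := σ) (isHomogeneous_one τ R) m)
  | insert a s ha ih =>
    rw [Finset.prod_insert ha, Finset.sum_insert ha]
    exact coeffHom_mul (h a (Finset.mem_insert_self a s))
      (ih fun i hi => h i (Finset.mem_insert_of_mem hi))

/-- Coefficientwise homogeneity is closed under negation. -/
theorem coeffHom_neg [CommRing R] {p : MvPolynomial σ (MvPolynomial τ R)} {k : ℕ}
    (hp : ∀ m, (p.coeff m).IsHomogeneous k) (m : σ →₀ ℕ) : ((-p).coeff m).IsHomogeneous k := by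
  rw [coeff_neg]
  exact (mem_homogeneousSubmodule _ _).mp
    (neg_mem ((mem_homogeneousSubmodule _ _).mpr (hp m)))

/-- Coefficientwise homogeneity is closed under sign changes (`ℤˣ`-scalars, e.g.
`Equiv.Perm.sign`). -/
theorem coeffHom_units_smul [CommRing R] (u : ℤˣ) {p : MvPolynomial σ (MvPolynomial τ R)}
    {k : ℕ} (hp : ∀ m, (p.coeff m).IsHomogeneous k) :
    ∀ m, ((u • p).coeff m).IsHomogeneous k := by
  rcases Int.units_eq_one_or u with rfl | rfl
  · rwa [one_smul]
  · rw [Units.neg_smul, one_smul]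
    exact coeffHom_neg hp

/-- The determinant of a square matrix all of whose entries are coefficientwise homogeneous of
degree `k` is coefficientwise homogeneous of degree `size * k` (`Matrix.det_apply`: a signed sum of
products of `size` entries). -/
theorem coeffHom_det [CommRing R] {n : Type*} [Fintype n] [DecidableEq n]
    (M : Matrix n n (MvPolynomial σ (MvPolynomial τ R))) {k : ℕ}
    (h : ∀ i j, ∀ m, ((M i j).coeff m).IsHomogeneous k) :
    ∀ m, (M.det.coeff m).IsHomogeneous (Fintype.card n * k) := by
  rw [Matrix.det_apply]
  refine coeffHom_sum _ _ _ fun π _ => coeffHom_units_smul _ ?_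
  have := coeffHom_prod Finset.univ (fun i => M (π i) i) (fun _ => k) fun i _ => h (π i) i
  simpa only [Finset.sum_const, smul_eq_mul, Finset.card_univ] using this

end CoeffHom

/-- Every `x`-coefficient of `det (A₀ + Σ_e x_e A_e)` (generic `5 × 5` pencil, unknowns the
entries) is a quintic FORM in the 250 unknowns: each entry has `x`-coefficients homogeneous of
degree `1` in the unknowns and `det` is a sum of signed products of five entries. -/
theorem stub_coef_isHomogeneous (μ : Fin 3 × Fin 3 →₀ ℕ) :
    ((Matrix.of fun i j : Fin 5 =>
        C (X (none, (i, j))) + ∑ e : Fin 3 × Fin 3, X e * C (X (some e, (i, j))) :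
          Matrix (Fin 5) (Fin 5) (MvPolynomial (Fin 3 × Fin 3)
            (MvPolynomial (Option (Fin 3 × Fin 3) × (Fin 5 × Fin 5)) ℂ))).det.coeff μ).IsHomogeneous
      5 := by
  have h : ∀ i j : Fin 5, ∀ m,
      (((Matrix.of fun i j : Fin 5 =>
        C (X (none, (i, j))) + ∑ e : Fin 3 × Fin 3, X e * C (X (some e, (i, j))) :
          Matrix (Fin 5) (Fin 5) (MvPolynomial (Fin 3 × Fin 3)
            (MvPolynomial (Option (Fin 3 × Fin 3) × (Fin 5 × Fin 5)) ℂ))) i j).coeff m).IsHomogeneous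
        1 := fun i j m => by
    rw [Matrix.of_apply, coeff_add]
    exact (coeffHom_C (isHomogeneous_X ℂ _) m).add
      (coeffHom_sum _ _ _ (fun e _ => coeffHom_X_mul_C e (isHomogeneous_X ℂ _)) m)
  have hdet := coeffHom_det _ h μ
  simpa only [Fintype.card_fin] using hdet

end Summit.ValiantsHypothesis.ValiantsHypothesis.Theorems.RefutationDegreeSmallCaseThreeFive
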